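import Summits.QuantumFields.BalabanUV.T4Continuum.Support.NE3CovariantLineSumsL2
import HarnessLib

/-!
# T⁴ programme, node NE3 — census R26′, step 2c-α: THE ONE-LEVEL LINEARISED AVERAGE IN ℓ¹(TORUS) — the straight part with the EXACT weight `L^{1−d}`,
# the defect with the small weight `16(d+1)(d+4)L²a·Csup·d(2·nbRad+1)^d`

Cell `pub-balaban-gaps` (YM blitz, track G2, seat `ne3`, unit `pub-balaban-gaps-ne3`; writer prover-pub-balaban-gaps-ne3-g4-0, 2026-08-23), census
`run/shared/lean/pub/pub-balaban-gaps/ne/NE3.md` §4 R26′ ∕ §10 F8.  WHY.  Finding F8: at `d = 4` the Π-REG majorant is removable by the ℓ² tower of one-step remainders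
(`RemainderTowerB8.sqrt_l2sq_QbarIter_le`, steps 1–2b) — for the ν-letter.  The ℓ¹-curl letter of the normal part, however, must stay QUADRATIC in the energy norm, which needs
the QUADRATIC ℓ¹ size `dirL1 φ ≲ M^{2−d}·dirSq Z`, and that needs an ℓ¹ → ℓ¹ bound of the LINEAR tower `QbarIter` with a NON-COMPOUNDING constant times `(L^{1−d})^m`
(step 2c-β: the ℓ¹ twin of `NE3CovariantLineSumsL2Tower[Sharp]`).  THIS FILE is its one-level input, the ℓ¹ twin of `NE3CovariantLineSumsL2` §2–§3: the straight covariant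
average `Qstr` contracts the torus ℓ¹ functional with the EXACT weight `L^{1−d}` (each fine bond lies on exactly one block line and under `L` starting points; isometric
transports), and the one-level defect `Dstr = Qbar − Qstr` is bounded by `16(d+1)(d+4)L²a·Csup·d·(2·nbRad+1)^d·dirL1 Y` (local ℓ¹ weight + box counting on the torus).

CONTENT (all [folklore]; 0 sorry; 0 def): **`dirL1_Qstr_le`** (`dirL1 (Qstr L W Y) (periodBox N′) ≤ (L∕L^d)·dirL1 Y (periodBox (L·N′))`), **`dirL1_Dstr_le`**
(`dirL1 (Dstr L W Y) (periodBox N′) ≤ 16(d+1)(d+4)L²a·Csup·d·(2·nbRad+1)^d·dirL1 Y (periodBox (L·N′))`).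

HONEST FRAMING.  One-level covariant kinematics on OUR frame ([Balaban1985Averaging] (120)–(125) context); the ℓ¹ tower, the quadratic `dirL1 φ` bound and the supplier re-wired
WITHOUT Π-REG are NOT here; NOTHING of Bałaban's is proved; **NE3 is NOT proved**; spine PROVED 0∕9; finite T⁴ rung (B)+1 — NOT continuum YM on ℝ⁴, NOT infinite volume, NOT mass
gap, NOT `BetaPertH`, NOT Clay.  PLACEMENT: `Summits/QuantumFields/BalabanUV/T4Continuum/Spine/NE3/`.
-/

set_option autoImplicit false

open scoped BigOperators Matrix.Norms.L2Operator
open Finset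

namespace Summit.QuantumFields.BalabanUV.T4Continuum.NE3.RemainderL1OneLevelB8

open Literature.MathematicalPhysics.QuantumFieldTheory.Balaban1983to89
open B7Prop1Explicit B7Prop2Explicit
open T4AveragingDeficitWall (IsUnitaryCfg SmallField dirL1 box)
open T4AveragingDeficitWallBoundary (IsPeriodicCfg periodBox)
open AveragingDeficitPeriodicCounting (IsPeriodicDir sum_periodBox_box_le)
open BlockAverageDbarLinBound (segL1)
open BlockAverageDbarLinNorms (lnorm_seg_eq_sum)
open BlockAverageVaryHolo (nbRad)
open NE3BlockLineAverage (sum_univ_boxVec)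
open NE3CovariantLineSums (Qstr locL1 norm_Qbar_sub_Qstr_le norm_Qstr_le)
open NE3CovariantLineSumsTower (Dstr)
open NE3CovariantLineSumsError (Csup Csup_nonneg)
open NE3CovariantLineSumsL2 (sum_tile_shift locL1_le_Csup_mul_dirL1)

noncomputable section

variable {d : ℕ} {n : Type*} [Fintype n] [DecidableEq n]

/-- **THE STRAIGHT COVARIANT AVERAGE IN ℓ¹(TORUS), EXACT WEIGHT `L∕L^d`**: for unitary small-field `W` (`512(d+1)(d+4)L²a ≤ 1`, `SmallField W a`) and an
`(L·N′)`-periodic `Y`: `dirL1 (Qstr L W Y) (periodBox N′) ≤ (L∕L^d)·dirL1 Y (periodBox (L·N′))`. [folklore] -/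
theorem dirL1_Qstr_le [Nonempty n] {L : ℕ} (hL : 1 ≤ L) {N' : ℕ} (hN' : 1 ≤ N') {W : Site d → Fin d → (Matrix n n ℂ)ˣ}
    (hWu : IsUnitaryCfg W) {a : ℝ} (ha : 0 ≤ a) (hsmall : 512 * (d + 1) * (d + 4) * (L : ℝ) ^ 2 * a ≤ 1) (hWa : SmallField W a)
    {Y : Site d → Fin d → Matrix n n ℂ} (hY : IsPeriodicDir Y ((L * N' : ℕ) : ℤ)) :
    dirL1 (Qstr L W Y) (periodBox (d := d) N') ≤ (L : ℝ) / (L : ℝ) ^ d * dirL1 Y (periodBox (d := d) (L * N')) := by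
  have hL0 : (0 : ℝ) < L := by exact_mod_cast (by omega : 0 < L)
  have hLd : (0 : ℝ) < (L : ℝ) ^ d := by positivity
  -- pointwise: `‖Qstr‖ ≤ (L^d)⁻¹·Σ_v Σ_i ‖Y(L•y + v + i e_κ) κ‖`
  have hpt : ∀ (y : Site d) (κ : Fin d), ‖Qstr L W Y y κ‖
      ≤ ((L : ℝ) ^ d)⁻¹ * ∑ v ∈ periodBox (d := d) L, ∑ i ∈ range L, ‖Y ((L : ℤ) • y + v + (i : ℤ) • e κ) κ‖ := by
    intro y κ
    have h1 := norm_Qstr_le hL hWu ha hsmall hWa Y y κ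
    have hseg : segL1 L Y ((L : ℤ) • y) κ
        = ((L : ℝ) ^ d)⁻¹ * ∑ v ∈ periodBox (d := d) L, ∑ i ∈ range L, ‖Y ((L : ℤ) • y + v + (i : ℤ) • e κ) κ‖ := by
      unfold segL1
      rw [← Finset.mul_sum, ← sum_univ_boxVec L (fun v => ∑ i ∈ range L, ‖Y ((L : ℤ) • y + v + (i : ℤ) • e κ) κ‖)]
      refine congrArg _ (Finset.sum_congr rfl fun r _ => ?_)
      rw [lnorm_seg_eq_sum]
    rw [hseg] at h1
    exact h1
  -- the exact tiling with `L` longitudinal shifts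
  have htile : ∀ κ : Fin d, ∑ y ∈ periodBox (d := d) N', ∑ v ∈ periodBox (d := d) L, ∑ i ∈ range L,
      ‖Y ((L : ℤ) • y + v + (i : ℤ) • e κ) κ‖ = L * ∑ x ∈ periodBox (d := d) (L * N'), ‖Y x κ‖ := by
    intro κ
    have hper : ∀ (x : Site d) (τ : Fin d), (fun x => ‖Y x κ‖) (x + ((L * N' : ℕ) : ℤ) • e τ) = (fun x => ‖Y x κ‖) x := by
      intro x τ; simp only; rw [hY x τ κ]
    exact sum_tile_shift hL hN' (fun x => ‖Y x κ‖) hper κ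
  unfold dirL1
  calc ∑ y ∈ periodBox (d := d) N', ∑ κ : Fin d, ‖Qstr L W Y y κ‖
      ≤ ∑ y ∈ periodBox (d := d) N', ∑ κ : Fin d,
          ((L : ℝ) ^ d)⁻¹ * ∑ v ∈ periodBox (d := d) L, ∑ i ∈ range L, ‖Y ((L : ℤ) • y + v + (i : ℤ) • e κ) κ‖ :=
        Finset.sum_le_sum fun y _ => Finset.sum_le_sum fun κ _ => hpt y κ
    _ = ((L : ℝ) ^ d)⁻¹ * ∑ κ : Fin d, ∑ y ∈ periodBox (d := d) N', ∑ v ∈ periodBox (d := d) L, ∑ i ∈ range L,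
          ‖Y ((L : ℤ) • y + v + (i : ℤ) • e κ) κ‖ := by
        rw [Finset.sum_comm, Finset.mul_sum]
        refine Finset.sum_congr rfl fun κ _ => ?_
        rw [Finset.mul_sum]
    _ = ((L : ℝ) ^ d)⁻¹ * ∑ κ : Fin d, (L * ∑ x ∈ periodBox (d := d) (L * N'), ‖Y x κ‖) := by
        congr 1; exact Finset.sum_congr rfl fun κ _ => htile κ
    _ = (L : ℝ) / (L : ℝ) ^ d * ∑ x ∈ periodBox (d := d) (L * N'), ∑ κ : Fin d, ‖Y x κ‖ := by
        rw [← Finset.mul_sum, Finset.sum_comm]; field_simp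

/-- **THE ONE-LEVEL DEFECT IN ℓ¹(TORUS)**: under the same hypotheses,
`dirL1 (Dstr L W Y) (periodBox N′) ≤ 16(d+1)(d+4)L²a·Csup·(d·(2·nbRad+1)^d)·dirL1 Y (periodBox (L·N′))` (local ℓ¹ weight `locL1 ≤ Csup·dirL1 (box nbRad)`, box
counting on the torus). [folklore] -/
theorem dirL1_Dstr_le [Nonempty n] {L : ℕ} (hL : 1 ≤ L) {N' : ℕ} (hN' : 1 ≤ N') {W : Site d → Fin d → (Matrix n n ℂ)ˣ}
    (hWu : IsUnitaryCfg W) {a : ℝ} (ha : 0 ≤ a) (hsmall : 512 * (d + 1) * (d + 4) * (L : ℝ) ^ 2 * a ≤ 1) (hWa : SmallField W a)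
    {Y : Site d → Fin d → Matrix n n ℂ} (hY : IsPeriodicDir Y ((L * N' : ℕ) : ℤ)) :
    dirL1 (Dstr L W Y) (periodBox (d := d) N')
      ≤ 16 * (d + 1) * (d + 4) * (L : ℝ) ^ 2 * a * Csup d L * (d * (2 * nbRad d L + 1) ^ d) * dirL1 Y (periodBox (d := d) (L * N')) := by
  have hC0 : 0 ≤ 16 * (d + 1) * (d + 4) * (L : ℝ) ^ 2 * a := by positivity
  have hCs := Csup_nonneg d L
  set g : Site d → ℝ := fun x => ∑ μ : Fin d, ‖Y x μ‖ with hg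
  have hg0 : ∀ x, 0 ≤ g x := fun x => Finset.sum_nonneg fun μ _ => norm_nonneg _
  have hgP : ∀ (x : Site d) (κ : Fin d), g (x + ((L * N' : ℕ) : ℤ) • e κ) = g x := by
    intro x κ
    simp only [hg]
    exact Finset.sum_congr rfl fun μ _ => by rw [hY x κ μ]
  have hpt : ∀ (y : Site d) (κ : Fin d), ‖Dstr L W Y y κ‖
      ≤ 16 * (d + 1) * (d + 4) * (L : ℝ) ^ 2 * a * Csup d L * ∑ x ∈ box (nbRad d L) ((L : ℤ) • y), g x := by
    intro y κ
    have h1 := norm_Qbar_sub_Qstr_le hL hWu ha hsmall hWa Y y κ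
    have h2 := locL1_le_Csup_mul_dirL1 L hL Y ((L : ℤ) • y) κ
    have e : dirL1 Y (box (nbRad d L) ((L : ℤ) • y)) = ∑ x ∈ box (nbRad d L) ((L : ℤ) • y), g x := rfl
    have h1' : ‖Dstr L W Y y κ‖ ≤ 16 * (d + 1) * (d + 4) * (L : ℝ) ^ 2 * a * locL1 L Y ((L : ℤ) • y) κ := h1
    calc ‖Dstr L W Y y κ‖ ≤ 16 * (d + 1) * (d + 4) * (L : ℝ) ^ 2 * a * locL1 L Y ((L : ℤ) • y) κ := h1'
      _ ≤ 16 * (d + 1) * (d + 4) * (L : ℝ) ^ 2 * a * (Csup d L * dirL1 Y (box (nbRad d L) ((L : ℤ) • y))) :=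
          mul_le_mul_of_nonneg_left h2 hC0
      _ = _ := by rw [e]; ring
  have hbox := sum_periodBox_box_le L N' hL hN' (nbRad d L) hg0 hgP
  unfold dirL1
  calc ∑ y ∈ periodBox (d := d) N', ∑ κ : Fin d, ‖Dstr L W Y y κ‖
      ≤ ∑ y ∈ periodBox (d := d) N', ∑ _κ : Fin d,
          16 * (d + 1) * (d + 4) * (L : ℝ) ^ 2 * a * Csup d L * ∑ x ∈ box (nbRad d L) ((L : ℤ) • y), g x :=
        Finset.sum_le_sum fun y _ => Finset.sum_le_sum fun κ _ => hpt y κ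
    _ = 16 * (d + 1) * (d + 4) * (L : ℝ) ^ 2 * a * Csup d L * (d * ∑ y ∈ periodBox (d := d) N', ∑ x ∈ box (nbRad d L) ((L : ℤ) • y), g x) := by
        rw [Finset.mul_sum, Finset.mul_sum]
        refine Finset.sum_congr rfl fun y _ => ?_
        rw [Finset.sum_const, Finset.card_univ, Fintype.card_fin, nsmul_eq_mul]; ring
    _ ≤ 16 * (d + 1) * (d + 4) * (L : ℝ) ^ 2 * a * Csup d L * (d * ((2 * nbRad d L + 1) ^ d * ∑ x ∈ periodBox (d := d) (L * N'), g x)) := by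
        refine mul_le_mul_of_nonneg_left (mul_le_mul_of_nonneg_left ?_ (by positivity)) (mul_nonneg hC0 hCs)
        exact_mod_cast hbox
    _ = _ := by rw [hg]; push_cast; ring

end

end Summit.QuantumFields.BalabanUV.T4Continuum.NE3.RemainderL1OneLevelB8
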